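import Summits.ResolutionOfSingularities.ResolutionOfSingularities.Theorems.FrobeniusLadderFInjectiveMacaulayficationF108ToricStarSC

/-!
# [OURS · L1 W4.5a · F-108 toric infrastructure 4/7] The Euclid stage: adding one generator to the support function

Given a state `S` (invariant bundle `Inv S`) all of whose cones are `Good 𝒜` — the support function `h_𝒜 = min_{b ∈ 𝒜} ⟨·, b⟩` is linear
on every cone — and a new exponent `a ≥ 0`, finitely many star subdivisions at EDGES produce a state all of whose cones are
`Good (insert a 𝒜)`.  On a `Good 𝒜` cone the difference `g = h_𝒜 − ⟨·, a⟩` is linear, so the cone is good for `insert a 𝒜` as soon as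
`g` does not take both signs on its rays.  RULE: star an edge `{ρ, ρ'}` of a cut cone with `|g ρ|` maximal among all rays of cut cones
and `g ρ · g ρ' < 0`, preferring `|g ρ'|` maximal too.  The new ray has value `g ρ + g ρ'` of absolute value `< M`; the potential
(`M` = that maximum, number of such extreme crossing pairs) drops lexicographically (`stage_step`), whatever else the star subdivides —
this is what makes the GLOBAL (fan-preserving) procedure terminate.  Boundary safety: `h_𝒜 ≤ 0` on rays with a zero coordinate, so the
positive endpoint of a crossing edge is interior and the starred face is valid.  ★ `stage`.
AI-written; weaker than expert review. Nothing here proves resolution of singularities in positive characteristic.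
-/

set_option linter.dupNamespace false

noncomputable section

namespace Summit.ResolutionOfSingularities.ResolutionOfSingularities.Theorems.FInjectiveMacaulayfication.F108Toric

open Matrix Finset

variable {n : ℕ}

/-! ## The support function of a finite exponent set and the crossing form -/

open Classical in
/-- `hA 𝒜 ρ = min_{b ∈ 𝒜} ⟨ρ, b⟩` (and `0` for empty `𝒜`). [OURS · bookkeeping] -/
def hA (𝒜 : Finset (Fin n → ℤ)) (ρ : Fin n → ℤ) : ℤ := if h : 𝒜.Nonempty then 𝒜.inf' h (fun b => ρ ⬝ᵥ b) else 0

/-- The crossing form of the stage: `g ρ = h_𝒜(ρ) − ⟨ρ, a⟩`. [OURS · bookkeeping] -/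
def gf (𝒜 : Finset (Fin n → ℤ)) (a : Fin n → ℤ) (ρ : Fin n → ℤ) : ℤ := hA 𝒜 ρ - ρ ⬝ᵥ a

/-- A cone is CUT when the crossing form takes both signs on its rays. [OURS · bookkeeping] -/
def Cut (𝒜 : Finset (Fin n → ℤ)) (a : Fin n → ℤ) (d : DCone n) : Prop :=
  (∃ i, 0 < gf 𝒜 a (d.ray i)) ∧ ∃ i, gf 𝒜 a (d.ray i) < 0

open Classical in
/-- `M` = the maximum of `|g|` over the rays of the cut cones. [OURS · bookkeeping] -/
def bigM (𝒜 : Finset (Fin n → ℤ)) (a : Fin n → ℤ) (S : Finset (DCone n)) : ℕ :=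
  (S.filter (Cut 𝒜 a)).sup fun d => univ.sup fun i => (gf 𝒜 a (d.ray i)).natAbs

open Classical in
/-- The extreme crossing pairs: ordered pairs of rays of a common cut cone, the first of absolute value `M`, of opposite signs.
[OURS · bookkeeping] -/
def ecp (𝒜 : Finset (Fin n → ℤ)) (a : Fin n → ℤ) (S : Finset (DCone n)) : Finset ((Fin n → ℤ) × (Fin n → ℤ)) :=
  ((S.filter (Cut 𝒜 a)).biUnion fun d => (univ ×ˢ univ).image fun p : Fin n × Fin n => (d.ray p.1, d.ray p.2)).filter
    fun q => (gf 𝒜 a q.1).natAbs = bigM 𝒜 a S ∧ gf 𝒜 a q.1 * gf 𝒜 a q.2 < 0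

section stage

variable {𝒜 : Finset (Fin n → ℤ)} {a : Fin n → ℤ}

/-- `h_𝒜(ρ) ≤ ⟨ρ, b⟩` for `b ∈ 𝒜`. -/
theorem hA_le (h𝒜 : 𝒜.Nonempty) {b : Fin n → ℤ} (hb : b ∈ 𝒜) (ρ : Fin n → ℤ) : hA 𝒜 ρ ≤ ρ ⬝ᵥ b := by
  unfold hA; rw [dif_pos h𝒜]; exact inf'_le _ hb

/-- `h_𝒜(ρ)` is attained. -/
theorem exists_hA_eq (h𝒜 : 𝒜.Nonempty) (ρ : Fin n → ℤ) : ∃ b ∈ 𝒜, hA 𝒜 ρ = ρ ⬝ᵥ b := by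
  unfold hA; rw [dif_pos h𝒜]; exact exists_mem_eq_inf' h𝒜 _

/-- On a good cone the support function is given by the common minimiser. -/
theorem hA_eq_of_good (h𝒜 : 𝒜.Nonempty) {d : DCone n} {b : Fin n → ℤ} (hb : b ∈ 𝒜) (hmin : ∀ i, ∀ b' ∈ 𝒜, d.ray i ⬝ᵥ b ≤ d.ray i ⬝ᵥ b')
    (i : Fin n) : hA 𝒜 (d.ray i) = d.ray i ⬝ᵥ b := by
  refine le_antisymm (hA_le h𝒜 hb _) ?_
  obtain ⟨b', hb', h⟩ := exists_hA_eq h𝒜 (d.ray i)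
  rw [h]; exact hmin i b' hb'

/-- Linearity of the crossing form on an edge of a good cone: `g(ρ + ρ') = g ρ + g ρ'`. -/
theorem gf_add_of_good (h𝒜 : 𝒜.Nonempty) {d : DCone n} (hg : Good 𝒜 d) (i j : Fin n) :
    gf 𝒜 a (d.ray i + d.ray j) = gf 𝒜 a (d.ray i) + gf 𝒜 a (d.ray j) := by
  obtain ⟨b, hb, hmin⟩ := hg
  have h : hA 𝒜 (d.ray i + d.ray j) = (d.ray i + d.ray j) ⬝ᵥ b := by
    refine le_antisymm (hA_le h𝒜 hb _) ?_
    obtain ⟨b', hb', h'⟩ := exists_hA_eq h𝒜 (d.ray i + d.ray j)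
    rw [h', add_dotProduct, add_dotProduct]
    exact add_le_add (hmin i b' hb') (hmin j b' hb')
  unfold gf
  rw [h, hA_eq_of_good h𝒜 hb hmin, hA_eq_of_good h𝒜 hb hmin, add_dotProduct, add_dotProduct]; ring

/-- A good cone which is not cut is good for the enlarged set. -/
theorem good_insert_of_not_cut (h𝒜 : 𝒜.Nonempty) {d : DCone n} (hg : Good 𝒜 d) (hnc : ¬ Cut 𝒜 a d) : Good (insert a 𝒜) d := by
  obtain ⟨b, hb, hmin⟩ := hg
  have hh := hA_eq_of_good h𝒜 hb hmin
  unfold Cut at hnc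
  by_cases hpos : ∃ i, 0 < gf 𝒜 a (d.ray i)
  · -- then no ray is negative: `a` is the new common minimiser
    have hnn : ∀ i, 0 ≤ gf 𝒜 a (d.ray i) := fun i => by
      by_contra hlt; exact hnc ⟨hpos, i, by omega⟩
    refine ⟨a, mem_insert_self _ _, fun i b' hb' => ?_⟩
    rcases mem_insert.1 hb' with rfl | hb'
    · exact le_rfl
    · have := hnn i; unfold gf at this; rw [hh] at this
      linarith [hmin i b' hb']
  · refine ⟨b, mem_insert_of_mem hb, fun i b' hb' => ?_⟩
    rcases mem_insert.1 hb' with rfl | hb'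
    · have : ¬ 0 < gf 𝒜 b' (d.ray i) := fun h => hpos ⟨i, h⟩
      unfold gf at this; rw [hh] at this; linarith
    · exact hmin i b' hb'

variable {S : Finset (DCone n)}

/-- `|g ρ| ≤ M` for a ray of a cut cone. -/
theorem natAbs_le_bigM {d : DCone n} (hd : d ∈ S) (hc : Cut 𝒜 a d) (i : Fin n) :
    (gf 𝒜 a (d.ray i)).natAbs ≤ bigM 𝒜 a S := by
  classical
  unfold bigM
  refine le_trans ?_ (le_sup (f := fun d : DCone n => univ.sup fun i => (gf 𝒜 a (d.ray i)).natAbs) (mem_filter.2 ⟨hd, hc⟩))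
  exact le_sup (f := fun i => (gf 𝒜 a (d.ray i)).natAbs) (mem_univ i)

/-- Membership in the set of extreme crossing pairs. -/
theorem mem_ecp {q : (Fin n → ℤ) × (Fin n → ℤ)} :
    q ∈ ecp 𝒜 a S ↔ (∃ d ∈ S, Cut 𝒜 a d ∧ ∃ i j, d.ray i = q.1 ∧ d.ray j = q.2) ∧
      (gf 𝒜 a q.1).natAbs = bigM 𝒜 a S ∧ gf 𝒜 a q.1 * gf 𝒜 a q.2 < 0 := by
  classical
  unfold ecp
  simp only [mem_filter, mem_biUnion, mem_image, mem_product, mem_univ, true_and, Prod.exists]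
  constructor
  · rintro ⟨⟨d, ⟨hd, hc⟩, i, j, hq⟩, h2⟩
    exact ⟨⟨d, hd, hc, i, j, (Prod.ext_iff.1 hq).1, (Prod.ext_iff.1 hq).2⟩, h2⟩
  · rintro ⟨⟨d, hd, hc, i, j, h1, h2⟩, h3⟩
    exact ⟨⟨d, ⟨hd, hc⟩, i, j, Prod.ext h1 h2⟩, h3⟩

/-- A positive ray of the crossing form is interior (boundary safety). -/
theorem one_le_of_gf_pos (hS : Inv S) (ha : ∀ j, 0 ≤ a j) (hbd : ∀ ρ : Fin n → ℤ, (∀ j, 0 ≤ ρ j) → (∃ j, ρ j = 0) → hA 𝒜 ρ ≤ 0)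
    {d : DCone n} (hd : d ∈ S) {i : Fin n} (hpos : 0 < gf 𝒜 a (d.ray i)) (j : Fin n) : 1 ≤ d.ray i j := by
  have hnz : ¬ ∃ j, d.ray i j = 0 := by
    intro hz
    have h1 := hbd (d.ray i) (hS.nonneg d hd i) hz
    have h2 : 0 ≤ d.ray i ⬝ᵥ a := by
      unfold dotProduct; exact sum_nonneg fun k _ => mul_nonneg (hS.nonneg d hd i k) (ha k)
    unfold gf at hpos; linarith
  rcases hS.stdOrPos d hd i with ⟨j₀, hj₀⟩ | h
  · by_contra hlt
    have hle : d.ray i j ≤ 0 := by omega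
    have := hS.nonneg d hd i j
    exact hnz ⟨j, le_antisymm hle this⟩
  · exact h j

/-- ★ THE STEP: if some cone is cut there is a valid edge whose star lowers the potential `(M, #ecp)` lexicographically, for every scale. -/
theorem stage_step (h𝒜 : 𝒜.Nonempty) (hS : Inv S) (ha : ∀ j, 0 ≤ a j) (hbd : ∀ ρ : Fin n → ℤ, (∀ j, 0 ≤ ρ j) → (∃ j, ρ j = 0) → hA 𝒜 ρ ≤ 0)
    (hgood : ∀ d ∈ S, Good 𝒜 d) (hcut : ∃ d ∈ S, Cut 𝒜 a d) :
    ∃ τ, ValidFace S τ ∧ ∀ N : ℤ, bigM 𝒜 a (dstar N S τ) < bigM 𝒜 a S ∨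
      (bigM 𝒜 a (dstar N S τ) = bigM 𝒜 a S ∧ (ecp 𝒜 a (dstar N S τ)).card < (ecp 𝒜 a S).card) := by
  classical
  have key : ∀ x : ℤ, ((x.natAbs : ℕ) : ℤ) = |x| := fun x => Int.natCast_natAbs x
  -- 1. an extreme crossing pair exists
  have hEne : (ecp 𝒜 a S).Nonempty := by
    obtain ⟨d₀, hd₀, hc₀⟩ := hcut
    have hne : (S.filter (Cut 𝒜 a)).Nonempty := ⟨d₀, mem_filter.2 ⟨hd₀, hc₀⟩⟩
    obtain ⟨d, hdm, hdM⟩ := exists_mem_eq_sup _ hne (fun d : DCone n => univ.sup fun i => (gf 𝒜 a (d.ray i)).natAbs)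
    obtain ⟨hd, hc⟩ := mem_filter.1 hdm
    obtain ⟨i, -, hi⟩ := exists_mem_eq_sup _ (univ_nonempty_iff.2 ⟨d.l⟩) (fun i => (gf 𝒜 a (d.ray i)).natAbs)
    have hM : bigM 𝒜 a S = (gf 𝒜 a (d.ray i)).natAbs := by unfold bigM; rw [hdM]; exact hi
    have hM1 : 1 ≤ bigM 𝒜 a S := by
      obtain ⟨i₁, hi₁⟩ := hc.1
      have := natAbs_le_bigM hd hc i₁
      omega
    have hgi : gf 𝒜 a (d.ray i) ≠ 0 := by intro h0; rw [h0] at hM; simp at hM; omega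
    rcases lt_or_gt_of_ne hgi with hneg | hpos
    · obtain ⟨i', hi'⟩ := hc.1
      exact ⟨(d.ray i, d.ray i'), mem_ecp.2 ⟨⟨d, hd, hc, i, i', rfl, rfl⟩, hM.symm, mul_neg_of_neg_of_pos hneg hi'⟩⟩
    · obtain ⟨i', hi'⟩ := hc.2
      exact ⟨(d.ray i, d.ray i'), mem_ecp.2 ⟨⟨d, hd, hc, i, i', rfl, rfl⟩, hM.symm, mul_neg_of_pos_of_neg hpos hi'⟩⟩
  -- 2. choose the pair, preferring both extreme
  obtain ⟨q, hq, hpref⟩ : ∃ q ∈ ecp 𝒜 a S, ((∃ q' ∈ ecp 𝒜 a S, (gf 𝒜 a q'.2).natAbs = bigM 𝒜 a S) →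
      (gf 𝒜 a q.2).natAbs = bigM 𝒜 a S) := by
    by_cases hb : ∃ q' ∈ ecp 𝒜 a S, (gf 𝒜 a q'.2).natAbs = bigM 𝒜 a S
    · obtain ⟨q', hq', h⟩ := hb; exact ⟨q', hq', fun _ => h⟩
    · obtain ⟨q, hq⟩ := hEne; exact ⟨q, hq, fun h => absurd h hb⟩
  obtain ⟨⟨d, hd, hc, p₁, p₂, hp₁, hp₂⟩, hqM, hqs⟩ := mem_ecp.1 hq
  obtain ⟨ρ, ρ'⟩ := q
  simp only at hp₁ hp₂ hqM hqs hpref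
  have hρρ' : ρ ≠ ρ' := by intro h; rw [h] at hqs; nlinarith
  have hne0 : gf 𝒜 a ρ ≠ 0 := fun h => by rw [h, zero_mul] at hqs; exact lt_irrefl _ hqs
  have hne0' : gf 𝒜 a ρ' ≠ 0 := fun h => by rw [h, mul_zero] at hqs; exact lt_irrefl _ hqs
  have hle' : (gf 𝒜 a ρ').natAbs ≤ bigM 𝒜 a S := by rw [← hp₂]; exact natAbs_le_bigM hd hc p₂
  -- integer forms of the absolute values
  have hzM : |gf 𝒜 a ρ| = bigM 𝒜 a S := by rw [← key, hqM]
  have hz' : |gf 𝒜 a ρ'| ≤ bigM 𝒜 a S := by rw [← key]; exact_mod_cast hle'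
  have hmemρ : ρ ∈ ({ρ, ρ'} : Finset (Fin n → ℤ)) := by simp
  have hmemρ' : ρ' ∈ ({ρ, ρ'} : Finset (Fin n → ℤ)) := by simp
  -- 3. the face and its validity
  refine ⟨{ρ, ρ'}, ?_, ?_⟩
  · refine ⟨by rw [card_pair hρρ'], ⟨d, hd, ?_⟩, ?_⟩
    · intro x hx
      rcases mem_insert.1 hx with rfl | hx
      · exact mem_rays.2 ⟨p₁, hp₁⟩
      · rw [mem_singleton.1 hx]; exact mem_rays.2 ⟨p₂, hp₂⟩
    · rcases lt_or_gt_of_ne hne0 with hneg | hpos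
      · have hpos' : 0 < gf 𝒜 a ρ' := by nlinarith
        refine ⟨ρ', hmemρ', ?_⟩
        rw [← hp₂] at hpos' ⊢; exact one_le_of_gf_pos hS ha hbd hd hpos'
      · refine ⟨ρ, hmemρ, ?_⟩
        rw [← hp₁] at hpos ⊢; exact one_le_of_gf_pos hS ha hbd hd hpos
  -- 4. the potential drops
  intro N
  have hbary : bary {ρ, ρ'} = ρ + ρ' := by unfold bary; rw [sum_pair hρρ']
  have hgb : gf 𝒜 a (bary {ρ, ρ'}) = gf 𝒜 a ρ + gf 𝒜 a ρ' := by
    rw [hbary, ← hp₁, ← hp₂]; exact gf_add_of_good h𝒜 (hgood d hd) p₁ p₂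
  have hgb_lt : (gf 𝒜 a (bary {ρ, ρ'})).natAbs < bigM 𝒜 a S := by
    suffices h : (((gf 𝒜 a (bary {ρ, ρ'})).natAbs : ℕ) : ℤ) < bigM 𝒜 a S by exact_mod_cast h
    rw [key, hgb]
    rcases mul_neg_iff.1 hqs with ⟨hp, hn⟩ | ⟨hn, hp⟩
    · rw [abs_of_pos hp] at hzM; rw [abs_of_neg hn] at hz'
      rw [abs_lt]; constructor <;> linarith
    · rw [abs_of_neg hn] at hzM; rw [abs_of_pos hp] at hz'
      rw [abs_lt]; constructor <;> linarith
  have hcut_aff : ∀ d₁ ∈ S, ({ρ, ρ'} : Finset (Fin n → ℤ)) ⊆ d₁.rays → Cut 𝒜 a d₁ := by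
    intro d₁ hd₁ hsub
    obtain ⟨k, hk⟩ := mem_rays.1 (hsub hmemρ)
    obtain ⟨k', hk'⟩ := mem_rays.1 (hsub hmemρ')
    rcases lt_or_gt_of_ne hne0 with hneg | hpos
    · exact ⟨⟨k', by rw [hk']; nlinarith⟩, ⟨k, by rw [hk]; exact hneg⟩⟩
    · exact ⟨⟨k, by rw [hk]; exact hpos⟩, ⟨k', by rw [hk']; nlinarith⟩⟩
  have hM' : bigM 𝒜 a (dstar N S {ρ, ρ'}) ≤ bigM 𝒜 a S := by
    unfold bigM
    refine Finset.sup_le fun c hc => Finset.sup_le fun i _ => ?_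
    obtain ⟨hc, hcc⟩ := mem_filter.1 hc
    obtain ⟨d₁, hd₁, h⟩ := mem_dstar.1 hc
    rcases h with ⟨hsub, i₀, hi₀, rfl⟩ | ⟨hnsub, rfl⟩
    · by_cases hi : i = i₀
      · rw [hi, child_ray_self]; exact le_trans hgb_lt.le le_rfl
      · rw [child_ray_of_ne _ _ _ hi]; exact natAbs_le_bigM hd₁ (hcut_aff d₁ hd₁ hsub) i
    · rw [scaleD_ray]
      exact natAbs_le_bigM hd₁ hcc i
  rcases hM'.lt_or_eq with hlt | heq
  · exact Or.inl hlt
  right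
  refine ⟨heq, ?_⟩
  -- with `M' = M`: `ecp S' ⊆ (ecp S).erase q`
  have hsub : ecp 𝒜 a (dstar N S {ρ, ρ'}) ⊆ (ecp 𝒜 a S).erase (ρ, ρ') := by
    intro q' hq'
    obtain ⟨⟨c, hc, hcc, i, j, hi, hj⟩, hq'M, hq's⟩ := mem_ecp.1 hq'
    rw [heq] at hq'M
    obtain ⟨d₁, hd₁, h⟩ := mem_dstar.1 hc
    rw [mem_erase]
    rcases h with ⟨hsub₁, i₀, hi₀, rfl⟩ | ⟨hnsub, rfl⟩
    · have hcut₁ := hcut_aff d₁ hd₁ hsub₁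
      have hi0 : i ≠ i₀ := by
        intro h; rw [h, child_ray_self] at hi; rw [← hi] at hq'M; omega
      rw [child_ray_of_ne _ _ _ hi0] at hi
      by_cases hj0 : j = i₀
      · -- the partner is the barycentre: contradiction with the preference rule
        exfalso
        rw [hj0, child_ray_self] at hj
        rw [← hj, hgb] at hq's
        by_cases hboth : (gf 𝒜 a ρ').natAbs = bigM 𝒜 a S
        · have hz'' : |gf 𝒜 a ρ'| = bigM 𝒜 a S := by rw [← key, hboth]
          have h0 : gf 𝒜 a ρ + gf 𝒜 a ρ' = 0 := by
            rcases mul_neg_iff.1 hqs with ⟨hp, hn⟩ | ⟨hn, hp⟩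
            · rw [abs_of_pos hp] at hzM; rw [abs_of_neg hn] at hz''; linarith
            · rw [abs_of_neg hn] at hzM; rw [abs_of_pos hp] at hz''; linarith
          rw [h0, mul_zero] at hq's; exact lt_irrefl _ hq's
        · apply hboth; apply hpref
          obtain ⟨k, hk⟩ := mem_rays.1 (hsub₁ hmemρ)
          refine ⟨(ρ, q'.1), mem_ecp.2 ⟨⟨d₁, hd₁, hcut₁, k, i, hk, hi⟩, hqM, ?_⟩, hq'M⟩
          -- `g q'.1` is opposite to `g ρ + g ρ'`, which has the sign of `g ρ`
          have hlt' : |gf 𝒜 a ρ'| < bigM 𝒜 a S := lt_of_le_of_ne hz' (fun h => hboth (by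
            have := key (gf 𝒜 a ρ'); rw [h] at this; exact_mod_cast this))
          show gf 𝒜 a ρ * gf 𝒜 a q'.1 < 0
          rcases mul_neg_iff.1 hqs with ⟨hp, hn⟩ | ⟨hn, hp⟩
          · rw [abs_of_pos hp] at hzM; rw [abs_of_neg hn] at hlt'
            have hs : 0 < gf 𝒜 a ρ + gf 𝒜 a ρ' := by linarith
            have hq1 : gf 𝒜 a q'.1 < 0 := by
              by_contra hge; push Not at hge; nlinarith
            exact mul_neg_of_pos_of_neg hp hq1
          · rw [abs_of_neg hn] at hzM; rw [abs_of_pos hp] at hlt'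
            have hs : gf 𝒜 a ρ + gf 𝒜 a ρ' < 0 := by linarith
            have hq1 : 0 < gf 𝒜 a q'.1 := by
              by_contra hge; push Not at hge; nlinarith
            exact mul_neg_of_neg_of_pos hn hq1
      · rw [child_ray_of_ne _ _ _ hj0] at hj
        refine ⟨?_, mem_ecp.2 ⟨⟨d₁, hd₁, hcut₁, i, j, hi, hj⟩, hq'M, hq's⟩⟩
        -- `q' ≠ q`: the child does not carry both `ρ` and `ρ'`
        intro heq'
        rw [heq'] at hi hj
        simp only at hi hj
        rcases mem_insert.1 hi₀ with h1 | h1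
        · exact hi0 (hS.ray_injective hd₁ (hi.trans h1.symm))
        · rw [mem_singleton] at h1; exact hj0 (hS.ray_injective hd₁ (hj.trans h1.symm))
    · refine ⟨?_, mem_ecp.2 ⟨⟨d₁, hd₁, hcc, i, j, hi, hj⟩, hq'M, hq's⟩⟩
      intro heq'
      rw [heq'] at hi hj
      simp only [scaleD_ray] at hi hj
      apply hnsub
      intro x hx
      rcases mem_insert.1 hx with rfl | hx
      · exact mem_rays.2 ⟨i, hi⟩
      · rw [mem_singleton.1 hx]; exact mem_rays.2 ⟨j, hj⟩
  calc (ecp 𝒜 a (dstar N S {ρ, ρ'})).card ≤ ((ecp 𝒜 a S).erase (ρ, ρ')).card := card_le_card hsub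
    _ < (ecp 𝒜 a S).card := card_erase_lt_of_mem hq

/-- ★ THE STAGE: from a state all of whose cones are `Good 𝒜`, finitely many valid stars reach a state all of whose cones are
`Good (insert a 𝒜)` (induction on the potential `(M, #ecp)`). -/
theorem stage (h𝒜 : 𝒜.Nonempty) (ha : ∀ j, 0 ≤ a j) (hbd : ∀ ρ : Fin n → ℤ, (∀ j, 0 ≤ ρ j) → (∃ j, ρ j = 0) → hA 𝒜 ρ ≤ 0) :
    ∀ S : Finset (DCone n), Inv S → (∀ d ∈ S, Good 𝒜 d) → ∃ S' : Finset (DCone n), Inv S' ∧ ∀ d ∈ S', Good (insert a 𝒜) d := by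
  classical
  suffices H : ∀ Mv Ev : ℕ, ∀ S : Finset (DCone n), bigM 𝒜 a S = Mv → (ecp 𝒜 a S).card = Ev → Inv S →
      (∀ d ∈ S, Good 𝒜 d) → ∃ S' : Finset (DCone n), Inv S' ∧ ∀ d ∈ S', Good (insert a 𝒜) d from
    fun S hS hg => H _ _ S rfl rfl hS hg
  intro Mv
  induction Mv using Nat.strong_induction_on with
  | _ Mv ihM =>
    intro Ev
    induction Ev using Nat.strong_induction_on with
    | _ Ev ihE =>
      intro S hM hE hS hg
      by_cases hcut : ∃ d ∈ S, Cut 𝒜 a d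
      · obtain ⟨τ, hτ, hdec⟩ := stage_step h𝒜 hS ha hbd hg hcut
        have hS' : Inv (dstar (2 * (bnd S τ : ℤ) + 2) S τ) := inv_dstar hS hτ le_rfl
        have hg' := good_dstar (τ := τ) hS hg (2 * (bnd S τ : ℤ) + 2)
        rcases hdec (2 * (bnd S τ : ℤ) + 2) with hlt | ⟨heq, hlt⟩
        · exact ihM _ (hM ▸ hlt) _ _ rfl rfl hS' hg'
        · exact ihE _ (hE ▸ hlt) _ (heq.trans hM) rfl hS' hg'
      · refine ⟨S, hS, fun d hd => good_insert_of_not_cut h𝒜 (hg d hd) fun hc => hcut ⟨d, hd, hc⟩⟩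

end stage

end Summit.ResolutionOfSingularities.ResolutionOfSingularities.Theorems.FInjectiveMacaulayfication.F108Toric

end
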